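import Mathlib
import Summits.ValiantsHypothesis.ValiantsHypothesis.Theorems.ProofCarryingSymmetryRestorationQPESatHom

/-!
# Route ProofCarryingSymmetry — crux `RestorationQP`, line `registered`: e-saturated normal forms —
fan-in of the classes reachable from the e-saturated unfolding

Support file for the crux item `stmt-ValiantsHypothesis-10343` (lead c5, rung S3^(1)-inv, stub
`esat_card_kids`), continuing `…ESatHom` (`nf_esat`).  For a GENERIC ground distributivity instance
`d` and a Hrubeš–Tzameret circuit `C`, every AC-class reachable along `kids` from
`esatClass d C = ⟦esat d C•⟧` has fewer than `2 ^ (|C| + 4)` flattened children (with multiplicity),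
independently of the size of the instance `P, Q, R`.  The size of `esat d C•` is useless here (the
expansion `sig` may be huge and is inserted many times); the proof is a LEAF COUNT: a normal form `u`
has at most `nvars u + 1` flattened children (`NF.length_kids_le`: at most one is a constant, the
others keep a variable leaf); `nvars (esat d K) ≤ 2 · nvars K` (`nvars_esat_le_two_mul`): the only new
leaves are those of the inserted copies of `sig`, each insertion adding `nvars p ≤ nvars sig / 2`
leaves and one OCCURRENCE of `sig` as a subformula, smart sums and products never losing one
(`nvars_esat_le`), while distinct occurrences are disjoint (`count_subs_mul_nvars_le`); hence a
reachable class — the class of a subformula of `esat d C•` — has at most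
`2 · nvars C• + 1 ≤ 2 |C•| + 1 < 2 ^ (|C| + 4)` children (`size_unfold_lt`).  Everything is proved.
-/

-- single-problem summit: `Summit.ValiantsHypothesis.ValiantsHypothesis.…` is the namespace by design (D-0017)
set_option linter.dupNamespace false

noncomputable section

open scoped Classical

namespace Summit.ValiantsHypothesis.ValiantsHypothesis.Theorems

namespace ACStability

open Literature.Computability.AlgebraicComplexity ACClass

universe u v

variable {𝔽 : Type u} {X : Type v}

/-! ### Leaf counts, sizes and occurrences of a subformula -/

/-- A formula has at most as many variable leaves as nodes. [folklore] -/
theorem nvars_le_size (F : PIFormula 𝔽 X) : nvars F ≤ F.size := by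
  induction F <;> simp <;> omega

/-- A formula larger than `F` does not occur in `F`. [folklore] -/
theorem count_subs_eq_zero_of_size_lt {F t : PIFormula 𝔽 X} (h : F.size < t.size) : (subs F).count t = 0 :=
  List.count_eq_zero.2 fun hm => absurd (size_le_of_mem_subs hm) (not_le.2 h)

/-- **Distinct occurrences of a subformula are disjoint**: the number of occurrences of `t` in `z`
times the leaf count of `t` is at most the leaf count of `z`. [folklore] -/
theorem count_subs_mul_nvars_le (z t : PIFormula 𝔽 X) : (subs z).count t * nvars t ≤ nvars z := by
  induction z with
  | add F G ihF ihG =>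
    by_cases h : PIFormula.add F G = t
    · subst h; rw [subs, List.count_cons_self, List.count_append, count_subs_eq_zero_of_size_lt (by simp),
        count_subs_eq_zero_of_size_lt (by simp)]; simp
    · simp only [subs, List.count_cons_of_ne h, List.count_append, nvars_add, add_mul]; omega
  | mul F G ihF ihG =>
    by_cases h : PIFormula.mul F G = t
    · subst h; rw [subs, List.count_cons_self, List.count_append, count_subs_eq_zero_of_size_lt (by simp),
        count_subs_eq_zero_of_size_lt (by simp)]; simp
    · simp only [subs, List.count_cons_of_ne h, List.count_append, nvars_mul, add_mul]; omega
  | _ =>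
    simp only [subs, List.count_cons, List.count_nil]
    split
    · rename_i h; simp only [beq_iff_eq] at h; subst h; simp
    · simp

/-- The children of a sum contain the occurrences of its summands. [folklore] -/
theorem count_subs_add_ge (a b t : PIFormula 𝔽 X) :
    (subs a).count t + (subs b).count t ≤ (subs (.add a b)).count t := by
  rw [← List.count_append]
  exact (List.sublist_cons_self (PIFormula.add a b) (subs a ++ subs b)).count_le t

/-- The children of a product contain the occurrences of its factors. [folklore] -/
theorem count_subs_mul_ge (a b t : PIFormula 𝔽 X) :
    (subs a).count t + (subs b).count t ≤ (subs (.mul a b)).count t := by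
  rw [← List.count_append]
  exact (List.sublist_cons_self (PIFormula.mul a b) (subs a ++ subs b)).count_le t

/-- Merging non-constant summands keeps the occurrences. [folklore] -/
theorem count_subs_amerge_ge (x y : Option (PIFormula 𝔽 X)) (t : PIFormula 𝔽 X) :
    x.elim 0 (fun p => (subs p).count t) + y.elim 0 (fun p => (subs p).count t) ≤
      (amerge x y).elim 0 (fun p => (subs p).count t) := by
  cases x <;> cases y <;> first | exact count_subs_add_ge _ _ t | simp

/-- Merging non-constant factors keeps the occurrences. [folklore] -/
theorem count_subs_mmerge_ge (x y : Option (PIFormula 𝔽 X)) (t : PIFormula 𝔽 X) :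
    x.elim 0 (fun p => (subs p).count t) + y.elim 0 (fun p => (subs p).count t) ≤
      (mmerge x y).elim 0 (fun p => (subs p).count t) := by
  cases x <;> cases y <;> first | exact count_subs_mul_ge _ _ t | simp

/-- A left comb contains the occurrences of its entries. [folklore] -/
theorem sum_count_subs_le_prodL (u : PIFormula 𝔽 X) (us : List (PIFormula 𝔽 X)) (t : PIFormula 𝔽 X) :
    ((u :: us).map fun f => (subs f).count t).sum ≤ (subs (prodL u us)).count t := by
  induction us generalizing u with
  | nil => simp
  | cons w ws ih =>
    rw [prodL_cons]; refine le_trans ?_ (ih (.mul u w))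
    have := count_subs_mul_ge u w t; simp only [List.map_cons, List.sum_cons]; omega

/-- Deleting formulas on which `g` vanishes does not change the sum of `g`. [folklore] -/
theorem sum_map_removeBy_eq {l : List (PIFormula 𝔽 X)} {M : Multiset (ACClass 𝔽 X)} (g : PIFormula 𝔽 X → ℕ)
    (h : ∀ f ∈ l, mk f ∈ M → g f = 0) : ((removeBy l M).map g).sum = (l.map g).sum := by
  induction l generalizing M with
  | nil => simp
  | cons f l ih =>
    by_cases hf : mk f ∈ M
    · rw [removeBy_cons_of_mem hf, ih fun g' hg' hM => h g' (List.mem_cons_of_mem f hg')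
        (Multiset.mem_of_mem_erase hM), List.map_cons, List.sum_cons, h f List.mem_cons_self hf, zero_add]
    · rw [removeBy_cons_of_not_mem hf, List.map_cons, List.map_cons, List.sum_cons, List.sum_cons,
        ih fun g' hg' hM => h g' (List.mem_cons_of_mem f hg') hM]

section Semiring

variable [CommSemiring 𝔽]

/-! ### A normal form has at most `nvars + 1` flattened children -/

/-- A non-constant normal form keeps a variable leaf. [folklore] -/
theorem NF.one_le_nvars {f : PIFormula 𝔽 X} (hf : NF f) (hc : constOf f = none) : 1 ≤ nvars f := by
  induction f with
  | var x => simp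
  | const c => simp at hc
  | add p q ihp _ =>
    obtain ⟨⟨hp, -⟩, hpn, -⟩ := nf_add_iff.1 hf; have := ihp hpn hp.constOf_eq; simp only [nvars_add]; omega
  | mul p q ihp _ =>
    obtain ⟨⟨hp, -⟩, hpn, -⟩ := nf_mul_iff.1 hf; have := ihp hpn hp.constOf_eq; simp only [nvars_mul]; omega

/-- A list of non-constant normal forms has at most as many entries as leaves. [folklore] -/
theorem length_le_sum_nvars {l : List (PIFormula 𝔽 X)} (h : ∀ g ∈ l, NF g ∧ constOf g = none) :
    l.length ≤ (l.map nvars).sum := by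
  have h' := List.length_le_sum_of_one_le (l.map nvars) fun n hn => by
    obtain ⟨g, hg', rfl⟩ := List.mem_map.1 hn
    exact (h g hg').1.one_le_nvars (h g hg').2
  rwa [List.length_map] at h'

/-- An additively pure normal form has at most `nvars` flattened summands. [folklore] -/
theorem length_addArgs_le_nvars {p : PIFormula 𝔽 X} (hn : NF p) (hp : APure p) :
    (addArgs p).length ≤ nvars p :=
  nvars_eq_sum_addArgs p ▸
    length_le_sum_nvars fun g hg' => ⟨hn.of_mem_subs (mem_subs_of_mem_addArgs hg'), hp g hg'⟩

/-- A multiplicatively pure normal form has at most `nvars` flattened factors. [folklore] -/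
theorem length_mulArgs_le_nvars {p : PIFormula 𝔽 X} (hn : NF p) (hp : MPure p) :
    (mulArgs p).length ≤ nvars p :=
  nvars_eq_sum_mulArgs p ▸
    length_le_sum_nvars fun g hg' => ⟨hn.of_mem_subs (mem_subs_of_mem_mulArgs hg'), hp g hg'⟩

/-- **A normal form has at most `nvars + 1` flattened children**: at most one of them is a
constant, the others keep a variable leaf. [folklore] -/
theorem NF.length_kids_le {u : PIFormula 𝔽 X} (hu : NF u) : (ACStability.kids u).length ≤ nvars u + 1 := by
  cases u with
  | var x => simp
  | const c => simp
  | add p q =>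
    obtain ⟨⟨hp, hq⟩, hpn, hqn⟩ := nf_add_iff.1 hu
    have h1 := length_addArgs_le_nvars hpn hp; rw [kids_add, List.length_append, nvars_add]
    rcases hq with ⟨k, -, rfl⟩ | hq
    · simp only [addArgs, List.length_cons, List.length_nil, nvars_const]; omega
    · have h2 := length_addArgs_le_nvars hqn hq; omega
  | mul p q =>
    obtain ⟨⟨hp, hq⟩, hpn, hqn⟩ := nf_mul_iff.1 hu
    have h1 := length_mulArgs_le_nvars hpn hp; rw [kids_mul, List.length_append, nvars_mul]
    rcases hq with ⟨k, -, -, rfl⟩ | hq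
    · simp only [mulArgs, List.length_cons, List.length_nil, nvars_const]; omega
    · have h2 := length_mulArgs_le_nvars hqn hq; omega

/-! ### Reassembling keeps occurrences and sums leaf counts -/

/-- Reassembling a sum keeps the occurrences of the non-constant part. [folklore] -/
theorem count_subs_amk_ge (m : Option (PIFormula 𝔽 X)) (c : 𝔽) (t : PIFormula 𝔽 X) :
    m.elim 0 (fun p => (subs p).count t) ≤ (subs (amk m c)).count t := by
  cases m with
  | none => exact Nat.zero_le _
  | some p =>
    by_cases hc : c = 0
    · subst hc; rw [amk_some_zero]; exact le_rfl
    · rw [amk_some_of_ne p hc]; exact (Nat.le_add_right _ _).trans (count_subs_add_ge p _ t)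

/-- Reassembling a product keeps the occurrences of the non-constant part. [folklore] -/
theorem count_subs_mmk_ge (m : Option (PIFormula 𝔽 X)) (c : 𝔽) (t : PIFormula 𝔽 X) :
    m.elim 0 (fun p => (subs p).count t) ≤ (subs (mmk m c)).count t := by
  cases m with
  | none => exact Nat.zero_le _
  | some p =>
    by_cases hc : c = 1
    · subst hc; rw [mmk_some_one]; exact le_rfl
    · rw [mmk_some_of_ne p hc]; exact (Nat.le_add_right _ _).trans (count_subs_mul_ge p _ t)

/-- Re-nesting a factor list keeps the occurrences of its entries. [folklore] -/
theorem sum_count_subs_le_mmk_olist (L : List (PIFormula 𝔽 X)) (c : 𝔽) (t : PIFormula 𝔽 X) :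
    (L.map fun f => (subs f).count t).sum ≤ (subs (mmk (olist L) c)).count t := by
  cases L with
  | nil => simp
  | cons u us =>
    rw [olist_cons]
    refine (sum_count_subs_le_prodL u us t).trans ?_
    by_cases hc : c = 1
    · subst hc; rw [mmk_some_one]
    · rw [mmk_some_of_ne _ hc]; exact (Nat.le_add_right _ _).trans (count_subs_mul_ge _ _ t)

/-- The leaves of a re-nested factor list. [folklore] -/
theorem nvars_mmk_olist (L : List (PIFormula 𝔽 X)) (c : 𝔽) : nvars (mmk (olist L) c) = (L.map nvars).sum := by
  cases L with
  | nil => simp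
  | cons u us => rw [olist_cons, nvars_mmk]; simp [nvars_prodL]

end Semiring

/-! ### Occurrences of the expansion -/

section Field

variable [Field 𝔽] {d : DistData 𝔽 X}

/-- The expansion of a generic instance is a sum of two genuine products: not a constant, not a
product, and without a constant right child. [folklore] -/
theorem DistData.Generic.sig_ne (hg : d.Generic) :
    (∀ k, d.sig ≠ .const k) ∧ (∀ a b, d.sig ≠ .mul a b) ∧ (∀ a k, d.sig ≠ .add a (.const k)) := by
  have hr := (DistData.constOf_smul_of_ne d.nf_p d.nf_r hg.mcst_mul_ne_zero.2 hg.1 hg.2.2).1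
  rw [hg.sig_eq]
  refine ⟨fun k h => (by cases h), fun a b h => (by cases h), fun a k h => ?_⟩
  injection h with _ h2; rw [h2] at hr; simp at hr

/-- A constant leaf contains no occurrence of the expansion. [folklore] -/
theorem count_sig_subs_const (hg : d.Generic) (k : 𝔽) : (subs (.const k : PIFormula 𝔽 X)).count d.sig = 0 :=
  List.count_eq_zero.2 (by simpa [subs] using hg.sig_ne.1 k)

/-- A formula with fewer leaves than the expansion contains no occurrence of it. [folklore] -/
theorem count_sig_eq_zero_of_nvars_lt {f : PIFormula 𝔽 X} (h : nvars f < nvars d.sig) :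
    (subs f).count d.sig = 0 :=
  List.count_eq_zero.2 fun hm => absurd (nvars_le_of_mem_subs hm) (not_le.2 h)

/-- All occurrences of the expansion in a normal form sit in its non-constant summand. [folklore] -/
theorem NF.count_sig_le_asplit (hg : d.Generic) {x : PIFormula 𝔽 X} (hx : NF x) :
    (subs x).count d.sig ≤ (asplit x).1.elim 0 (fun p => (subs p).count d.sig) := by
  rcases hx.ashape with ⟨k, rfl⟩ | ha | ⟨p, k, rfl, -, -⟩
  · rw [count_sig_subs_const hg k]; exact Nat.zero_le _
  · rw [ha.asplit_eq]; exact le_rfl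
  · rw [asplit_add_const]
    show ((PIFormula.add p (.const k)) :: (subs p ++ subs (.const k))).count d.sig ≤ (subs p).count d.sig
    rw [List.count_cons_of_ne (hg.sig_ne.2.2 p k).symm, List.count_append, count_sig_subs_const hg k, Nat.add_zero]

/-- All occurrences of the expansion in a normal form sit in its non-constant factor. [folklore] -/
theorem NF.count_sig_le_msplit (hg : d.Generic) {x : PIFormula 𝔽 X} (hx : NF x) :
    (subs x).count d.sig ≤ (msplit x).1.elim 0 (fun p => (subs p).count d.sig) := by
  rcases hx.mshape with ⟨k, rfl⟩ | hm | ⟨p, k, rfl, -, -, -⟩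
  · rw [count_sig_subs_const hg k]; exact Nat.zero_le _
  · rw [hm.msplit_eq]; exact le_rfl
  · rw [msplit_mul_const]
    show ((PIFormula.mul p (.const k)) :: (subs p ++ subs (.const k))).count d.sig ≤ (subs p).count d.sig
    rw [List.count_cons_of_ne (hg.sig_ne.2.1 p _).symm, List.count_append, count_sig_subs_const hg k, Nat.add_zero]

/-- **Smart sums never lose an occurrence of the expansion.** [folklore] -/
theorem count_sig_sadd_ge (hg : d.Generic) {x y : PIFormula 𝔽 X} (hx : NF x) (hy : NF y) :
    (subs x).count d.sig + (subs y).count d.sig ≤ (subs (sadd x y)).count d.sig := by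
  rw [sadd]
  exact (Nat.add_le_add (hx.count_sig_le_asplit hg) (hy.count_sig_le_asplit hg)).trans
    ((count_subs_amerge_ge _ _ _).trans (count_subs_amk_ge _ _ _))

/-- **Smart products (not killed by `0`) never lose an occurrence of the expansion.** [folklore] -/
theorem count_sig_smul_ge (hg : d.Generic) {x y : PIFormula 𝔽 X} (hx : NF x) (hy : NF y)
    (h0 : mcst x * mcst y ≠ 0) :
    (subs x).count d.sig + (subs y).count d.sig ≤ (subs (smul x y)).count d.sig := by
  rw [smul_of_ne_zero h0]
  exact (Nat.add_le_add (hx.count_sig_le_msplit hg) (hy.count_sig_le_msplit hg)).trans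
    ((count_subs_mmerge_ge _ _ _).trans (count_subs_mmk_ge _ _ _))

/-- The occurrences of the expansion in a formula sit in its flattened factors. [folklore] -/
theorem count_sig_le_sum_mulArgs (hg : d.Generic) (m : PIFormula 𝔽 X) :
    (subs m).count d.sig ≤ ((mulArgs m).map fun f => (subs f).count d.sig).sum := by
  induction m with
  | mul a b iha ihb =>
    rw [mulArgs_mul, List.map_append, List.sum_append]
    refine le_trans ?_ (Nat.add_le_add iha ihb)
    show ((PIFormula.mul a b) :: (subs a ++ subs b)).count d.sig ≤ _
    rw [List.count_cons_of_ne (hg.sig_ne.2.1 a b).symm, List.count_append]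
  | _ => simp [mulArgs]

/-- **The occurrences of the expansion in a normal form sit in its root factors.** [folklore] -/
theorem NF.count_sig_le_sum_margs (hg : d.Generic) {x : PIFormula 𝔽 X} (hx : NF x) :
    (subs x).count d.sig ≤ ((margs x).map fun f => (subs f).count d.sig).sum := by
  refine (hx.count_sig_le_msplit hg).trans ?_
  rw [margs_def]
  cases (msplit x).1 with
  | none => simp
  | some m => exact count_sig_le_sum_mulArgs hg m

/-! ### Leaf counts under peeling and the e-saturation -/

/-- The leaves of the factors surviving a peeling of `k` copies of the pattern. [folklore] -/
theorem sum_nvars_removeBy_add {w : PIFormula 𝔽 X} {k : ℕ} (hle : k • d.pat ≤ mset w) :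
    ((removeBy (margs w) (k • d.pat)).map nvars).sum + k * d.patVars = nvars w := by
  have e := congrArg (fun M : Multiset (ACClass 𝔽 X) => (M.map ACClass.nvars).sum)
    (coe_map_mk_removeBy (margs w) (M := k • d.pat) hle)
  simp only [Multiset.map_coe, Multiset.sum_coe, List.map_map] at e
  have hcomp : (ACClass.nvars ∘ mk : PIFormula 𝔽 X → ℕ) = nvars := rfl
  rw [hcomp] at e; rw [e, ← mset_def]
  have e' := congrArg (fun M : Multiset (ACClass 𝔽 X) => (M.map ACClass.nvars).sum) (tsub_add_cancel_of_le hle)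
  simp only [Multiset.map_add, Multiset.sum_add, Multiset.map_nsmul, Multiset.sum_nsmul, smul_eq_mul,
    DistData.pat_nvars_sum, mset_nvars_sum] at e'
  exact e'

/-- **Peeling trades leaves for occurrences of the expansion**: each peeled copy of the pattern
adds `nvars p` leaves and one occurrence of `sig`, and destroys no occurrence. [folklore] -/
theorem nvars_epeel_le (hg : d.Generic) {w : PIFormula 𝔽 X} (hw : NF w) :
    nvars (epeel d w) + (subs w).count d.sig * nvars d.p ≤
      nvars w + (subs (epeel d w)).count d.sig * nvars d.p := by
  by_cases hk : kmax (mset w) d.pat = 0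
  · rw [epeel_of_kmax_eq_zero d hk]
  · rw [epeel_of_kmax_ne_zero d hk]
    set k := kmax (mset w) d.pat with hk_def
    have hle : k • d.pat ≤ mset w := nsmul_kmax_le _ _
    -- leaves: the surviving factors keep `nvars w - k · patVars` leaves, the new ones bring `k · nvars sig`
    have h2 : ((removeBy (margs w) (k • d.pat)).map nvars).sum + k * d.patVars = nvars w :=
      sum_nvars_removeBy_add hle
    have h3 : k * nvars d.sig = k * nvars d.p + k * d.patVars := by
      rw [hg.nvars_sig, DistData.patVars, d.nvars_s]; ring
    -- occurrences: the deleted factors contain none, the new factors are `k` copies of `sig`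
    have h4 : ((removeBy (margs w) (k • d.pat)).map fun f => (subs f).count d.sig).sum =
        ((margs w).map fun f => (subs f).count d.sig).sum :=
      sum_map_removeBy_eq _ fun f _ hf =>
        count_sig_eq_zero_of_nvars_lt (hg.nvars_lt_of_mem_pat (Multiset.mem_of_mem_nsmul hf))
    have h5 := hw.count_sig_le_sum_margs hg
    have h6 := sum_count_subs_le_mmk_olist (removeBy (margs w) (k • d.pat) ++ List.replicate k d.sig)
      (mcst w * d.cP⁻¹ ^ k) d.sig
    have h8 : k ≤ k * (subs d.sig).count d.sig :=
      Nat.le_mul_of_pos_right k (List.count_pos_iff.2 (mem_subs_self _))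
    rw [nvars_mmk_olist]
    generalize (subs (mmk (olist (removeBy (margs w) (k • d.pat) ++ List.replicate k d.sig))
      (mcst w * d.cP⁻¹ ^ k))).count d.sig = n at h6 ⊢
    simp only [List.map_append, List.sum_append, List.map_replicate, List.sum_replicate, smul_eq_mul, h4] at h6 ⊢
    have h9 := Nat.mul_le_mul_right (nvars d.p) (show (subs w).count d.sig + k ≤ n by omega)
    rw [add_mul] at h9
    omega

/-- **Leaf count of the e-saturation**: `nvars (esat d K) ≤ nvars K + (#occurrences of sig) · nvars p`.
[folklore] -/
theorem nvars_esat_le (hg : d.Generic) (K : PIFormula 𝔽 X) :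
    nvars (esat d K) ≤ nvars K + (subs (esat d K)).count d.sig * nvars d.p := by
  induction K with
  | var x => exact Nat.le_add_right _ _
  | const c => exact Nat.le_add_right _ _
  | add a b iha ihb =>
    have h := Nat.mul_le_mul_right (nvars d.p) (count_sig_sadd_ge hg (nf_esat hg a) (nf_esat hg b))
    rw [esat_add, nvars_sadd, nvars_add]; rw [add_mul] at h; omega
  | mul a b iha ihb =>
    rw [esat_mul, nvars_mul]
    by_cases h0 : mcst (esat d a) * mcst (esat d b) = 0
    · rw [emul_of_mcst_eq_zero h0]; simp
    · have hx := nf_esat hg a; have hy := nf_esat hg b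
      have hnw : nvars (smul (esat d a) (esat d b)) = nvars (esat d a) + nvars (esat d b) :=
        nvars_smul_of_ne _ _ h0
      have how := Nat.mul_le_mul_right (nvars d.p) (count_sig_smul_ge hg hx hy h0)
      have hp := nvars_epeel_le hg (nf_smul hx hy)
      rw [emul]; rw [add_mul] at how; omega

/-- **The e-saturation at most doubles the number of variable leaves.** [folklore] -/
theorem nvars_esat_le_two_mul (hg : d.Generic) (K : PIFormula 𝔽 X) : nvars (esat d K) ≤ 2 * nvars K := by
  have h1 := nvars_esat_le hg K
  have h2 := count_subs_mul_nvars_le (esat d K) d.sig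
  have h3 : 2 * ((subs (esat d K)).count d.sig * nvars d.p) ≤ (subs (esat d K)).count d.sig * nvars d.sig := by
    rw [hg.nvars_sig, mul_left_comm]
    exact Nat.mul_le_mul_left _ (by omega)
  omega

/-- **Fan-in of the reachable classes**: a class reachable from `⟦esat d K⟧` has at most
`2 · nvars K + 1` flattened children. [folklore] -/
theorem card_kids_le_of_mem_reach_esat (hg : d.Generic) (K : PIFormula 𝔽 X) {q : ACClass 𝔽 X}
    (hq : q ∈ reach (mk (esat d K))) : Multiset.card q.kids ≤ 2 * nvars K + 1 := by
  obtain ⟨u, hu, rfl⟩ := exists_mem_subs_of_reaches (mem_reach.1 hq)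
  have h1 := ((nf_esat hg K).of_mem_subs hu).length_kids_le
  have h2 := nvars_le_of_mem_subs hu; have h3 := nvars_esat_le_two_mul hg K
  rw [kids_mk, Multiset.coe_card, List.length_map]; omega

end Field

end ACStability

open Literature.Computability.AlgebraicComplexity in
/-- **Registered stub `esat_card_kids`** (line `registered` of crux `RestorationQP`, item
stmt-ValiantsHypothesis-10343, rung S3^(1)-inv): for a generic ground distributivity instance `d`,
every AC-class reachable from the class of the e-saturated unfolding of a Hrubeš–Tzameret circuit `C`
has fewer than `2 ^ (|C| + 4)` flattened children, with multiplicity — a bound independent of the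
size of the instance (`ACStability.card_kids_le_of_mem_reach_esat`: at most `2 · nvars C• + 1`).
[folklore] -/
theorem esat_card_kids : ∀ {𝔽 : Type} [Field 𝔽] {X : Type} (d : ACStability.DistData 𝔽 X), d.Generic → ∀ (C : PICircuit 𝔽 X), ∀ q ∈ ACStability.ACClass.reach (ACStability.esatClass d C), Multiset.card q.kids < 2 ^ (C.size + 4) :=
  fun d hg C q hq => by
    have h1 := ACStability.card_kids_le_of_mem_reach_esat hg C.unfold hq
    have h2 := ACStability.nvars_le_size C.unfold; have h3 := ACStability.size_unfold_lt C
    have h4 : 2 ^ (C.size + 4) = 8 * 2 ^ (C.size + 1) := by ring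
    omega

end Summit.ValiantsHypothesis.ValiantsHypothesis.Theorems

end
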